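import Mathlib
import HarnessLib
import Summits.NavierStokesRegularity.NavierStokesRegularity.Theorems.CompletionRelayChainPhaseISoundDist

/-!
# Route `CompletionRelayChain` — crux `RelayFrontStep` (stmt-NavierStokesRegularity-24850), K-side of `stub_phaseI`,
  work package K5-e: the extended block curve `zc`, its velocity `zv`, and THE DISTURBANCE BOUND `dist_le_delta`:
  within one step, as long as the block has stayed in the a priori box, `|zv − fieldR(zc, zc)|_c ≤ deltaC_c`

MODEL-lattice bookkeeping (rung TL-M3-R64); nothing here is a statement about the Navier–Stokes equations.
-/

noncomputable section

set_option linter.dupNamespace false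

namespace Summit.NavierStokesRegularity.NavierStokesRegularity.Cruxes.RelayFrontStep.PhaseI

open Set Checker MeasureTheory
open Literature.Analysis.FluidPDE.TaoCascade

variable {α : Fin 4 → Fin 4 → Fin 4 → ℤ × ℤ × ℤ → ℝ} {τ : ℝ} {S₀ F₀ B₀ : Fin 4 → ℤ → ℝ} {S F : Fin 4 → ℤ → ℝ → ℝ}

/-! ### The extended block curve -/

/-- The real step `h = 1/64`. [this file] -/
def hR : ℝ := 1 / 64

/-- `Checker.h` is `hR`. [this file] -/
theorem cast_h : ((Checker.h : ℚ) : ℝ) = hR := by simp [Checker.h, hR]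

/-- Decode an index `< 18` to a block index. [this file] -/
def dec (c : Fin 19) (hc : c.val < 18) : BIdx := (⟨c.val / 3, by omega⟩, ⟨c.val % 3, Nat.mod_lt _ (by norm_num)⟩)

/-- `enc (dec c) = c`. [this file] -/
theorem enc_dec (c : Fin 19) (hc : c.val < 18) : enc (dec c hc) = c := by
  apply Fin.ext; simp only [enc, dec]; omega

/-- The extended block curve `t ↦ ext (blockState S t)`. [this file] -/
def zc (S : Fin 4 → ℤ → ℝ → ℝ) (t : ℝ) : Fin 19 → ℝ := ext (blockState S t)

/-- `zc` at an encoded index. [this file] -/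
theorem zc_enc (S : Fin 4 → ℤ → ℝ → ℝ) (t : ℝ) (d : BIdx) :
    zc S t (enc d) = S (blockMode d.2) (((d.1 : ℕ) : ℤ) - 3) t := by
  simp [zc, blockState]

/-- `zc` at the constant coordinate. [this file] -/
theorem zc_last (S : Fin 4 → ℤ → ℝ → ℝ) (t : ℝ) : zc S t (18 : Fin 19) = 1 := by simp [zc]

/-- `zc` at `u₂`. [this file] -/
theorem zc_u2 (S : Fin 4 → ℤ → ℝ → ℝ) (t : ℝ) : zc S t (cix 5 1) = S 1 2 t := by
  have h := zc_enc S t ((5 : Fin 6), (1 : Fin 3)); exact h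

/-- `zc` at `r₂`. [this file] -/
theorem zc_r2 (S : Fin 4 → ℤ → ℝ → ℝ) (t : ℝ) : zc S t (cix 5 2) = S 2 2 t := by
  have h := zc_enc S t ((5 : Fin 6), (2 : Fin 3)); exact h

/-- `zc` at `cix s i`. [this file] -/
theorem zc_cix (S : Fin 4 → ℤ → ℝ → ℝ) (t : ℝ) {s i : ℕ} (hs : s < 6) (hi : i < 3) :
    zc S t (cix s i) = S (blockMode ⟨i, hi⟩) ((s : ℤ) - 3) t := by
  rw [show cix s i = enc (⟨s, hs⟩, ⟨i, hi⟩) from Fin.ext (by simp [cix, enc]; omega)]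
  exact zc_enc S t _

/-- The extended block curve at the twelve envelope components. [this file] -/
theorem zc_table (S : Fin 4 → ℤ → ℝ → ℝ) (t : ℝ) :
    zc S t (cix 3 0) = S 0 0 t ∧ zc S t (cix 3 1) = S 1 0 t ∧ zc S t (cix 3 2) = S 2 0 t ∧
    zc S t (cix 4 0) = S 0 1 t ∧ zc S t (cix 4 1) = S 1 1 t ∧ zc S t (cix 4 2) = S 2 1 t ∧
    zc S t (cix 5 0) = S 0 2 t ∧ zc S t (cix 5 1) = S 1 2 t ∧ zc S t (cix 5 2) = S 2 2 t ∧
    zc S t (cix 2 0) = S 0 (-1) t ∧ zc S t (cix 2 1) = S 1 (-1) t ∧ zc S t (cix 2 2) = S 2 (-1) t := by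
  exact ⟨rfl, rfl, rfl, rfl, rfl, rfl, rfl, rfl, rfl, rfl, rfl, rfl⟩

/-- The velocity of the extended block curve (zero on the constant coordinate). [this file] -/
def zv (S : Fin 4 → ℤ → ℝ → ℝ) (τ t : ℝ) : Fin 19 → ℝ := fun c =>
  if hc : c.val < 18 then blockVel S τ t (dec c hc) else 0

/-- `zv` at an encoded index. [this file] -/
theorem zv_enc (S : Fin 4 → ℤ → ℝ → ℝ) (τ t : ℝ) (d : BIdx) : zv S τ t (enc d) = blockVel S τ t d := by
  have h := enc_val_lt d
  simp only [zv, dif_pos h]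
  congr 1
  exact enc_injective (enc_dec _ h)

/-- Membership of a real vector in a box of rational intervals. [this file] -/
def InBoxR (B : V19 IV) (y : Fin 19 → ℝ) : Prop := ∀ c : Fin 19, IV.mem (B[c]) (y c)

/-- In a box, every coordinate is bounded by the magnitude. [this file] -/
theorem abs_le_mag_of_inBoxR {B : V19 IV} {y : Fin 19 → ℝ} (hy : InBoxR B y) (c : Fin 19) :
    |y c| ≤ (((B[c]).mag : ℚ) : ℝ) := IV.abs_le_mag (hy c)

/-! ### Integral bookkeeping of `u₂²` and `|r₂u₂|` over a partial step -/

/-- Continuity of the amplitudes on `[0,τ]`. [this file] -/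
theorem continuousOn_S (H : Hyps α τ S₀ F₀ B₀ S F) (i : Fin 4) (k : ℤ) : ContinuousOn (S i k) (Icc 0 τ) :=
  (H.hflow.contDiffOn_S i k).continuousOn

/-- `∫₀^{a+σ} u₂² ≤ I₁ + σ·m₁₆²` when `∫₀^a u₂² ≤ I₁` and `|u₂| ≤ m₁₆` on `[a, a+σ]`. [this file] -/
theorem integral_u2sq_le (H : Hyps α τ S₀ F₀ B₀ S F) {a σ I m : ℝ} (ha : 0 ≤ a) (hσ : 0 ≤ σ) (haτ : a + σ ≤ τ)
    (hI : (∫ s in (0:ℝ)..a, S 1 2 s ^ 2) ≤ I) (hm : ∀ r ∈ Icc (0:ℝ) σ, |S 1 2 (a + r)| ≤ m) :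
    (∫ s in (0:ℝ)..(a + σ), S 1 2 s ^ 2) ≤ I + σ * m ^ 2 := by
  have hc : ContinuousOn (fun s => S 1 2 s ^ 2) (Icc 0 τ) := (continuousOn_S H 1 2).pow 2
  have hi1 : IntervalIntegrable (fun s => S 1 2 s ^ 2) volume 0 a :=
    (hc.mono (Icc_subset_Icc_right (by linarith))).intervalIntegrable_of_Icc ha
  have hi2 : IntervalIntegrable (fun s => S 1 2 s ^ 2) volume a (a + σ) :=
    (hc.mono (Icc_subset_Icc (by linarith) haτ)).intervalIntegrable_of_Icc (by linarith)
  rw [← intervalIntegral.integral_add_adjacent_intervals hi1 hi2]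
  have hb : ∀ s ∈ Set.uIoc a (a + σ), ‖S 1 2 s ^ 2‖ ≤ m ^ 2 := by
    intro s hs
    rw [Set.uIoc_of_le (by linarith)] at hs
    have hr : s - a ∈ Icc (0:ℝ) σ := ⟨by linarith [hs.1], by linarith [hs.2]⟩
    have h1 := hm (s - a) hr
    rw [show a + (s - a) = s by ring] at h1
    rw [Real.norm_eq_abs, abs_pow, sq_abs]
    have h0 : 0 ≤ m := (abs_nonneg _).trans h1
    nlinarith [abs_nonneg (S 1 2 s), sq_abs (S 1 2 s)]
  have key := intervalIntegral.norm_integral_le_of_norm_le_const hb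
  rw [Real.norm_eq_abs, show |a + σ - a| = σ by rw [add_sub_cancel_left, abs_of_nonneg hσ]] at key
  linarith [le_abs_self (∫ s in a..(a + σ), S 1 2 s ^ 2)]

/-- `∫₀^{a+σ} |r₂u₂| ≤ I₂ + σ·m₁₆·m₁₇`. [this file] -/
theorem integral_r2u2_le (H : Hyps α τ S₀ F₀ B₀ S F) {a σ I m n : ℝ} (ha : 0 ≤ a) (hσ : 0 ≤ σ) (haτ : a + σ ≤ τ)
    (hI : (∫ s in (0:ℝ)..a, |S 2 2 s * S 1 2 s|) ≤ I) (hm : ∀ r ∈ Icc (0:ℝ) σ, |S 1 2 (a + r)| ≤ m)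
    (hn : ∀ r ∈ Icc (0:ℝ) σ, |S 2 2 (a + r)| ≤ n) :
    (∫ s in (0:ℝ)..(a + σ), |S 2 2 s * S 1 2 s|) ≤ I + σ * (m * n) := by
  have hc : ContinuousOn (fun s => |S 2 2 s * S 1 2 s|) (Icc 0 τ) :=
    ((continuousOn_S H 2 2).mul (continuousOn_S H 1 2)).abs
  have hi1 : IntervalIntegrable (fun s => |S 2 2 s * S 1 2 s|) volume 0 a :=
    (hc.mono (Icc_subset_Icc_right (by linarith))).intervalIntegrable_of_Icc ha
  have hi2 : IntervalIntegrable (fun s => |S 2 2 s * S 1 2 s|) volume a (a + σ) :=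
    (hc.mono (Icc_subset_Icc (by linarith) haτ)).intervalIntegrable_of_Icc (by linarith)
  rw [← intervalIntegral.integral_add_adjacent_intervals hi1 hi2]
  have hb : ∀ s ∈ Set.uIoc a (a + σ), ‖|S 2 2 s * S 1 2 s|‖ ≤ m * n := by
    intro s hs
    rw [Set.uIoc_of_le (by linarith)] at hs
    have hr : s - a ∈ Icc (0:ℝ) σ := ⟨by linarith [hs.1], by linarith [hs.2]⟩
    have h1 := hm (s - a) hr
    have h2 := hn (s - a) hr
    rw [show a + (s - a) = s by ring] at h1 h2
    rw [Real.norm_eq_abs, abs_abs, abs_mul]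
    have : 0 ≤ m := (abs_nonneg _).trans h1
    calc |S 2 2 s| * |S 1 2 s| ≤ n * m := mul_le_mul h2 h1 (abs_nonneg _) ((abs_nonneg _).trans h2)
      _ = m * n := mul_comm _ _
  have key := intervalIntegral.norm_integral_le_of_norm_le_const hb
  rw [Real.norm_eq_abs, show |a + σ - a| = σ by rw [add_sub_cancel_left, abs_of_nonneg hσ]] at key
  linarith [le_abs_self (∫ s in a..(a + σ), |S 2 2 s * S 1 2 s|)]

/-! ### The disturbance bound -/

/-- Forcing radius part of `deltaC` for a block component. [this file] -/
def fRad (B : V19 IV) (c : Fin 19) : ℚ :=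
  if c.val = 0 then FR0
  else if c.val = 1 then FR1
  else if c.val = 16 then 32 * (B[cix 5 1]).mag * X3 + (B[cix 5 2]).mag * X3
  else if c.val = 17 then 2 * (B[cix 5 1]).mag * X3
  else 0

/-- `deltaC` on a block component, unfolded. [this file] -/
theorem deltaC_enc (B : V19 IV) (emax : V19 ℚ) (d : BIdx) :
    deltaC B emax (enc d) = kappa * fourPow (enc d) * sqrtUp (fbar B emax (enc d)) + fRad B (enc d) := by
  have h := enc_val_lt d
  have h18 : ¬ (enc d).val = 18 := by omega
  simp only [deltaC, h18, if_false, fRad]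

/-- `cix 5 1 = enc (5,1)`, `cix 5 2 = enc (5,2)`. [this file] -/
theorem cix_five : cix 5 1 = enc ((5 : Fin 6), (1 : Fin 3)) ∧ cix 5 2 = enc ((5 : Fin 6), (2 : Fin 3)) :=
  ⟨by decide, by decide⟩

/-- **The forcing minus its centre is within the forcing radius** (under (W) always; under (T) via the integral
premises at time `t`). [this file] -/
theorem forcing_sub_centre_le (H : Hyps α τ S₀ F₀ B₀ S F) {t : ℝ} (ht0 : 0 ≤ t) (htT : t ≤ 147 / 64)
    (hI1 : (∫ s in (0:ℝ)..t, S 1 2 s ^ 2) ≤ 1 / 10 ^ 11) (hI2 : (∫ s in (0:ℝ)..t, |S 2 2 s * S 1 2 s|) ≤ 1 / 10 ^ 13)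
    {B : V19 IV} (hbox : InBoxR B (zc S t)) (d : BIdx) :
    |blockForcing S t d - (if d = ((0 : Fin 6), (0 : Fin 3)) then ((FR0 : ℚ) : ℝ) else 0)| ≤ ((fRad B (enc d) : ℚ) : ℝ) := by
  have hx3 := shell3_abs_le H ht0 htT hI1 hI2
  have hu2 : |S 1 2 t| ≤ (((B[cix 5 1]).mag : ℚ) : ℝ) := by
    have h := abs_le_mag_of_inBoxR hbox (cix 5 1); rwa [zc_u2] at h
  have hr2 : |S 2 2 t| ≤ (((B[cix 5 2]).mag : ℚ) : ℝ) := by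
    have h := abs_le_mag_of_inBoxR hbox (cix 5 2); rwa [zc_r2] at h
  have hm51 : (0 : ℝ) ≤ (((B[cix 5 1]).mag : ℚ) : ℝ) := (abs_nonneg _).trans hu2
  have hX3 : (0 : ℝ) ≤ ((X3 : ℚ) : ℝ) := (abs_nonneg _).trans (hx3 0)
  by_cases h00 : d = ((0 : Fin 6), (0 : Fin 3))
  · subst h00
    obtain ⟨h1, h2⟩ := forcing_x3 H ht0 htT
    have : fRad B (enc ((0 : Fin 6), (0 : Fin 3))) = FR0 := by simp [fRad, enc]
    rw [if_pos rfl, this, abs_le]; constructor <;> linarith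
  rw [if_neg h00, sub_zero]
  by_cases h01 : d = ((0 : Fin 6), (1 : Fin 3))
  · subst h01
    have : fRad B (enc ((0 : Fin 6), (1 : Fin 3))) = FR1 := by simp [fRad, enc]
    rw [this]; exact forcing_u3 H ht0 htT
  by_cases h51 : d = ((5 : Fin 6), (1 : Fin 3))
  · subst h51
    have hf : fRad B (enc ((5 : Fin 6), (1 : Fin 3))) = 32 * (B[cix 5 1]).mag * X3 + (B[cix 5 2]).mag * X3 := by
      simp [fRad, enc]
    rw [hf]
    have hne1 : ((5 : Fin 6), (1 : Fin 3)) ≠ ((0 : Fin 6), (0 : Fin 3)) := by decide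
    have hne2 : ((5 : Fin 6), (1 : Fin 3)) ≠ ((0 : Fin 6), (1 : Fin 3)) := by decide
    simp only [blockForcing, hne1, hne2, if_false, if_true, lam_two]
    push_cast
    calc |-(32 * (S 1 2 t * S 0 3 t)) - 32 / 32 * (S 0 3 t * S 2 2 t)|
        ≤ |32 * (S 1 2 t * S 0 3 t)| + |32 / 32 * (S 0 3 t * S 2 2 t)| := by
          rw [show -(32 * (S 1 2 t * S 0 3 t)) - 32 / 32 * (S 0 3 t * S 2 2 t)
            = -(32 * (S 1 2 t * S 0 3 t) + 32 / 32 * (S 0 3 t * S 2 2 t)) by ring, abs_neg]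
          exact abs_add_le _ _
      _ = 32 * (|S 1 2 t| * |S 0 3 t|) + |S 0 3 t| * |S 2 2 t| := by
          rw [abs_mul, abs_mul, abs_mul, abs_mul]; norm_num
      _ ≤ 32 * ((((B[cix 5 1]).mag : ℚ) : ℝ) * ((X3 : ℚ) : ℝ)) + ((X3 : ℚ) : ℝ) * (((B[cix 5 2]).mag : ℚ) : ℝ) :=
          add_le_add (mul_le_mul_of_nonneg_left (mul_le_mul hu2 (hx3 0) (abs_nonneg _) hm51) (by norm_num))
            (mul_le_mul (hx3 0) hr2 (abs_nonneg _) hX3)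
      _ = _ := by ring
  by_cases h52 : d = ((5 : Fin 6), (2 : Fin 3))
  · subst h52
    have hf : fRad B (enc ((5 : Fin 6), (2 : Fin 3))) = 2 * (B[cix 5 1]).mag * X3 := by simp [fRad, enc]
    rw [hf]
    have hne1 : ((5 : Fin 6), (2 : Fin 3)) ≠ ((0 : Fin 6), (0 : Fin 3)) := by decide
    have hne2 : ((5 : Fin 6), (2 : Fin 3)) ≠ ((0 : Fin 6), (1 : Fin 3)) := by decide
    have hne3 : ((5 : Fin 6), (2 : Fin 3)) ≠ ((5 : Fin 6), (1 : Fin 3)) := by decide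
    simp only [blockForcing, hne1, hne2, hne3, if_false, if_true, lam_two]
    push_cast
    rw [show (32 : ℝ) / 32 * (S 0 3 t * S 1 2 t - S 1 2 t * S 1 3 t) = S 1 2 t * (S 0 3 t - S 1 3 t) by ring, abs_mul]
    calc |S 1 2 t| * |S 0 3 t - S 1 3 t| ≤ (((B[cix 5 1]).mag : ℚ) : ℝ) * (((X3 : ℚ) : ℝ) + ((X3 : ℚ) : ℝ)) := by
          refine mul_le_mul hu2 ((abs_sub _ _).trans (add_le_add (hx3 0) (hx3 1))) (abs_nonneg _)
            ((abs_nonneg _).trans hu2)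
      _ = _ := by ring
  -- all other components: no forcing
  have hbf : blockForcing S t d = 0 := by
    simp only [blockForcing, h00, h01, h51, h52, if_false]
  have hfr : 0 ≤ fRad B (enc d) := by
    simp only [fRad]
    have := IV.mag_nonneg (B[cix 5 1]); have := IV.mag_nonneg (B[cix 5 2])
    have hx : (0 : ℚ) ≤ X3 := le_of_lt (sqrtUp_pos _)
    split_ifs <;> first | positivity | (simp [FR0, FR1, Checker.Tstar]; try positivity)
  rw [hbf, abs_zero]; exact_mod_cast hfr

/-- **THE DISTURBANCE BOUND.** Step starting at `a = m·h`; at time `a + σ` with the block in the box `B` on `[a, a+σ]`,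
the integral premises up to `a` and the running maxima up to `a` (when `m > 0`), and the step's (T)-test passed:
`|zv − fieldR(zc,zc)|_c ≤ deltaC_c` for every component. [this file] -/
theorem dist_le_delta (H : Hyps α τ S₀ F₀ B₀ S F) (h2 : Shell2Bound F₀ S F) {m : ℕ}
    (hmT : ((m : ℝ) + 1) * hR ≤ 147 / 64) {st : State} {B : V19 IV}
    (hI1 : (∫ s in (0:ℝ)..((m : ℝ) * hR), S 1 2 s ^ 2) ≤ (st.I1 : ℝ))
    (hI2 : (∫ s in (0:ℝ)..((m : ℝ) * hR), |S 2 2 s * S 1 2 s|) ≤ (st.I2 : ℝ))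
    (hemax : 0 < m → ∀ r ∈ Icc (0:ℝ) ((m : ℝ) * hR), ∀ c : Fin 19, |zc S r c| ≤ ((st.emax[c] : ℚ) : ℝ))
    (hokT : st.I1 + Checker.h * ((B[cix 5 1]).mag * (B[cix 5 1]).mag) ≤ 1 / 10 ^ 11 ∧
      st.I2 + Checker.h * ((B[cix 5 1]).mag * (B[cix 5 2]).mag) ≤ 1 / 10 ^ 13)
    {σ : ℝ} (hσ : σ ∈ Icc (0:ℝ) hR) (hhist : ∀ r ∈ Icc (0:ℝ) σ, InBoxR B (zc S ((m : ℝ) * hR + r))) (c : Fin 19) :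
    |zv S τ ((m : ℝ) * hR + σ) c - fieldR (zc S ((m : ℝ) * hR + σ)) (zc S ((m : ℝ) * hR + σ)) c| ≤
      ((deltaC B st.emax c : ℚ) : ℝ) := by
  set a : ℝ := (m : ℝ) * hR with ha
  set t : ℝ := a + σ with htdef
  have hm0 : (0 : ℝ) ≤ m := Nat.cast_nonneg m
  have ha0 : 0 ≤ a := mul_nonneg hm0 (by norm_num [hR])
  have ht0 : 0 ≤ t := add_nonneg ha0 hσ.1
  have htT : t ≤ 147 / 64 := by have := hσ.2; rw [htdef, ha]; nlinarith [hmT]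
  have ht8 : t ≤ 8 := htT.trans (by norm_num)
  have htτ : t ∈ Icc (0:ℝ) τ := ⟨ht0, ht8.trans H.hτ⟩
  have hboxt : InBoxR B (zc S t) := hhist σ ⟨hσ.1, le_rfl⟩
  -- the constant coordinate
  by_cases hc : c.val < 18
  swap
  · have hc18 : c = (18 : Fin 19) := by apply Fin.ext; have := c.isLt; simp; omega
    subst hc18
    have : deltaC B st.emax (18 : Fin 19) = 1 / 2 ^ P := by simp [deltaC]
    rw [this, fieldR_last]
    simp only [zv, show ¬ ((18 : Fin 19).val < 18) by decide, dif_neg, not_false_eq_true, sub_zero, abs_zero]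
    positivity
  -- a block component
  obtain ⟨d, rfl⟩ : ∃ d, enc d = c := ⟨dec c hc, enc_dec c hc⟩
  obtain ⟨s, i⟩ := d
  rw [zv_enc, deltaC_enc]
  have hz : zc S t = ext (blockState S t) := rfl
  rw [hz, fieldR_ext_enc]
  -- split: defect + (forcing − centre)
  have hvel := blockVel_sub_field_le H.hflow H.hrows t htτ (s, i)
  have hI1t : (∫ s in (0:ℝ)..t, S 1 2 s ^ 2) ≤ 1 / 10 ^ 11 := by
    have hu : ∀ r ∈ Icc (0:ℝ) σ, |S 1 2 (a + r)| ≤ (((B[cix 5 1]).mag : ℚ) : ℝ) := fun r hr => by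
      have h := abs_le_mag_of_inBoxR (hhist r hr) (cix 5 1); rwa [zc_u2] at h
    have h1 := integral_u2sq_le H ha0 hσ.1 htτ.2 hI1 hu
    have h2 : σ * (((B[cix 5 1]).mag : ℚ) : ℝ) ^ 2 ≤ hR * (((B[cix 5 1]).mag : ℚ) : ℝ) ^ 2 :=
      mul_le_mul_of_nonneg_right hσ.2 (sq_nonneg _)
    have h3 := (Rat.cast_le (K := ℝ)).2 hokT.1
    push_cast at h3; rw [cast_h] at h3
    nlinarith
  have hI2t : (∫ s in (0:ℝ)..t, |S 2 2 s * S 1 2 s|) ≤ 1 / 10 ^ 13 := by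
    have hu : ∀ r ∈ Icc (0:ℝ) σ, |S 1 2 (a + r)| ≤ (((B[cix 5 1]).mag : ℚ) : ℝ) := fun r hr => by
      have h := abs_le_mag_of_inBoxR (hhist r hr) (cix 5 1); rwa [zc_u2] at h
    have hr : ∀ r ∈ Icc (0:ℝ) σ, |S 2 2 (a + r)| ≤ (((B[cix 5 2]).mag : ℚ) : ℝ) := fun r hr => by
      have h := abs_le_mag_of_inBoxR (hhist r hr) (cix 5 2); rwa [zc_r2] at h
    have h1 := integral_r2u2_le H ha0 hσ.1 htτ.2 hI2 hu hr
    have hmn : 0 ≤ (((B[cix 5 1]).mag : ℚ) : ℝ) * (((B[cix 5 2]).mag : ℚ) : ℝ) :=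
      mul_nonneg (by exact_mod_cast IV.mag_nonneg _) (by exact_mod_cast IV.mag_nonneg _)
    have h2 : σ * ((((B[cix 5 1]).mag : ℚ) : ℝ) * (((B[cix 5 2]).mag : ℚ) : ℝ)) ≤
        hR * ((((B[cix 5 1]).mag : ℚ) : ℝ) * (((B[cix 5 2]).mag : ℚ) : ℝ)) := mul_le_mul_of_nonneg_right hσ.2 hmn
    have h3 := (Rat.cast_le (K := ℝ)).2 hokT.2
    push_cast at h3; rw [cast_h] at h3
    linarith
  have hforc := forcing_sub_centre_le H ht0 htT hI1t hI2t hboxt (s, i)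
  -- the defect term
  have hnow : |S (blockMode i) (((s : ℕ) : ℤ) - 3) t| ≤ (((B[enc (s, i)]).mag : ℚ) : ℝ) := by
    rw [← zc_enc S t (s, i)]; exact abs_le_mag_of_inBoxR hboxt _
  have hhist2 : s.val = 5 → ∀ r ∈ Icc (0:ℝ) t, |S (blockMode i) 2 r| ≤
      max (((B[enc (s, i)]).mag : ℚ) : ℝ) ((st.emax[enc (s, i)] : ℚ) : ℝ) := by
    intro hs5 r hr
    have hs' : (((s : ℕ) : ℤ) - 3) = 2 := by rw [hs5]; norm_num
    by_cases hra : r ≤ a ∧ 0 < m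
    · have h1 := hemax hra.2 r ⟨hr.1, hra.1⟩ (enc (s, i))
      rw [zc_enc, hs'] at h1
      exact h1.trans (le_max_right _ _)
    · -- r ∈ [a, t]: in the box
      have hra' : a ≤ r := by
        by_cases hm : 0 < m
        · have hn : ¬ r ≤ a := fun h => hra ⟨h, hm⟩
          exact (not_le.1 hn).le
        · have hm0 : m = 0 := by omega
          have : a = 0 := by rw [ha, hm0]; simp
          rw [this]; exact hr.1
      have hr' : r - a ∈ Icc (0:ℝ) σ := ⟨by linarith, by linarith [hr.2]⟩
      have h1 := abs_le_mag_of_inBoxR (hhist (r - a) hr') (enc (s, i))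
      rw [show a + (r - a) = r by ring, zc_enc, hs'] at h1
      exact h1.trans (le_max_left _ _)
  have hF := energy_le_fbar H h2 s i ht0 htT (B := B) (emax := st.emax) hnow hhist2
  have hF0 : 0 ≤ F (blockMode i) (((s : ℕ) : ℤ) - 3) t := H.hflow.nonneg_F _ _ t htτ
  have hsqrt : Real.sqrt (F (blockMode i) (((s : ℕ) : ℤ) - 3) t) ≤ ((sqrtUp (fbar B st.emax (enc (s, i))) : ℚ) : ℝ) :=
    (Real.sqrt_le_sqrt hF).trans (sqrt_le_sqrtUp (by have := hF0.trans hF; exact_mod_cast this))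
  have hdef : |blockVel S τ t (s, i) - relayQ (blockState S t) (blockState S t) (s, i) - blockForcing S t (s, i)| ≤
      ((kappa : ℚ) : ℝ) * ((fourPow (enc (s, i)) : ℚ) : ℝ) * ((sqrtUp (fbar B st.emax (enc (s, i))) : ℚ) : ℝ) := by
    refine hvel.trans ?_
    rw [rpow_two_mul_eq_fourPow s i, show ((kappa : ℚ) : ℝ) = 1 / 10 ^ 8 by simp [Checker.kappa]]
    refine mul_le_mul_of_nonneg_left hsqrt ?_
    have : (0 : ℝ) ≤ ((fourPow (enc (s, i)) : ℚ) : ℝ) := by rw [fourPow]; push_cast; positivity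
    positivity
  push_cast
  calc |blockVel S τ t (s, i) - (relayQ (blockState S t) (blockState S t) (s, i) +
          (if (s, i) = ((0 : Fin 6), (0 : Fin 3)) then ((FR0 : ℚ) : ℝ) else 0))|
      = |(blockVel S τ t (s, i) - relayQ (blockState S t) (blockState S t) (s, i) - blockForcing S t (s, i)) +
          (blockForcing S t (s, i) - (if (s, i) = ((0 : Fin 6), (0 : Fin 3)) then ((FR0 : ℚ) : ℝ) else 0))| := by
        ring_nf
    _ ≤ _ := (abs_add_le _ _).trans (add_le_add hdef hforc)

end Summit.NavierStokesRegularity.NavierStokesRegularity.Cruxes.RelayFrontStep.PhaseI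

end
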